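import Summits.HodgeConjecture.HodgeConjecture.Theorems.F0P3cStCharTSWeylCartanWIF   -- ★ (E2b) (F0P3a-p05 g22) WIF by shape; brings ★ (E1b) `integral_cartanSet_eq_of_tubeJacobian_local`, ★ (E3), ★ «ELL-TOR★» Radial
import HarnessLib

/-!
# F0 · P3c · line LH6 «StCharTS» — ROAD «UP-TR» (A0) «INTEGRABILITY»: THE TORUS-SIDE TERMS OF THE WEYL INTEGRATION FORMULA ARE INTEGRABLE
# AS SOON AS THE GROUP-SIDE INTEGRAND IS (Rogawski 1990 §12.5 pp. 182–183; Harish-Chandra 1970 Lemma 42)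

Cell `pub/hodgecm-mathlib`, crux H413 = `stmt-HodgeConjecture-24833` (lane `--supports`, helper); seat F0P2-p01 (g23); ROAD «UP-TR» (LEAD T14-21 «A»
2026-09-02T18:13:47Z; holder ∕ dealer F0P3-p02 (g23); brick (A0) dealt 18:18:30Z; CENSUS-A0 v1 dffde32e53b6c2a7).  THEOREMS ONLY; sorry-free; no definition ∕
instance ∕ notation ∕ named fact; ★-only imports; axioms TRIO.

WHAT THIS FILE IS FOR.  The consequent `hUpTr` of RUNG0's named block ([Rogawski1990 §12.5 p. 183, L. 12.5.1]: `∫_G f · α^G = ∫_H f^H · α`) carries exactly two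
integrability hypotheses, on the GROUP sides (`Integrable (f · up α) νQv`, `Integrable (fH · α) νHv`).  Its in-house proof (bricks (N2)(N3)(A1) of the road) rewrites both
sides by Weyl integration formulas (★ (E2b) on `G`, (H5) on `H`) into FINITE SUMS OF TORUS INTEGRALS and matches them stable class by stable class after transport
to a common parameter torus (★ `map_eq_of_apply_compactCore_eq_one`).  Adding and transporting those torus integrals as BOCHNER integrals requires each torus term to be
INTEGRABLE — and that is PRODUCED here from the group-side hypothesis alone, with no extra letter: it is the first conjunct of ★ (E1b)
`F0P3cStCharTSWeylCartanJacobian.integral_cartanSet_eq_of_tubeJacobian_local` (the product integrability of `(t, q) ↦ g(Φ(q, t))` for `(D · tm|_{T^{reg}}) ⊗ μ₀`) read through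
Mathlib's `Integrable.integral_prod_left` ∕ `integrable_withDensity_iff_integrable_coe_smul` ∕ `ae_withDensity_iff`.  (Design note of the census: integrals are never split BELOW
the torus — the norm-fibre summands of `up α` are not separately integrable under `hUpTr`'s hypotheses.)

CONTENT (frame, letters and the local tube-Jacobian socket `hJacLoc` ∕ `hJac` VERBATIM those of ★ (E1b) §2 ∕ ★ (E2b) §3; `G = Gqs L v`, `v` non-split, `T = Z(γ₀)` a Cartan
subgroup, `Φ (q, t) = x t x⁻¹`, `μ₀ = ν ∕ tm` the quotient measure, `D : T → ℝ≥0` the weight, `G_T` the `T`-regular set):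
* §1 `integrableOn_weighted_orbital_of_integrableOn` — `g` integrable on `G_T` ⇒ `t ↦ D t • ∫_{G⧸T} g(Φ(q,t)) dμ₀` integrable on `T^{reg}` for `tm`;
  `ae_integrable_orbital_of_integrableOn` — and for `tm`-a.e. regular `t` with `D t ≠ 0`, `q ↦ g(Φ(q,t))` is `μ₀`-integrable (the orbital integral of `g` at `t` converges).
* §2 `integrableOn_weighted_classFun_mul_orbital` — for `g = f · α`, `α` a class function on the regular set: `t ↦ D t • (α t · ∫_{G⧸T} f(Φ(q,t)) dμ₀)` integrable on `T^{reg}`.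
* §3 `integrableOn_weighted_classFun_mul_classOrbitalIntegral` — the same in the (S-𝔇) organ's currency `classOrbitalIntegral mQv f ⟦t⟧` (★ (E3)), for the CANONICAL
  family `mQv` and THE Haar measure `t_T` of mass one on `compactCore T`; and the `ι`-indexed corollary `integrableOn_weighted_classOrbitalIntegral_of_integrable` in ★ (E2b)
  §3's letters (`T i = Z(γ i)`, `tT i`, `D i`, `hJac i`), term `i` of `integral_mul_classFun_eq_sum_classOrbitalIntegral_of_tubeJacobians`.
HONEST LABEL: count-neutral; block consequents 11 → 10 → 9 only at the rider editions; organs 2 = 2; h413 registry untouched; HC_CM is proved only modulo the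
printed citations until rung 0 closes.

## References
* [Rogawski1990] J. D. Rogawski, *Automorphic Representations of Unitary Groups in Three Variables*, Ann. of Math. Stud. 123 (1990), §12.5 pp. 182–183
  (Weyl integration formula; «`α ↦ α^G` is given by integration against a class function», Lemma 12.5.1).
* [HarishChandra1970] Harish-Chandra (notes by G. van Dijk), *Harmonic analysis on reductive p-adic groups*, LNM 162 (1970), Part V §4 Lemma 22, Lemma 42.
-/

set_option autoImplicit false
-- the mandated namespace has the single-problem summit's repeated segment (`HodgeConjecture.HodgeConjecture`)
set_option linter.dupNamespace false

noncomputable section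

open MeasureTheory Measure Set Filter Topology Function NumberField IsDedekindDomain Matrix Polynomial
open Literature.MeasureTheory.Group
open Literature.NumberTheory.Automorphic Literature.NumberTheory.Automorphic.UnitaryGroup Literature.NumberTheory.Rogawski1990
open Summit.HodgeConjecture.HodgeConjecture.Cruxes.H413.F0P3cStCharTSWeylCartanRadial
open Summit.HodgeConjecture.HodgeConjecture.Cruxes.H413.F0P3cStCharTSWeylCartanJacobian
open Summit.HodgeConjecture.HodgeConjecture.Cruxes.H413.F0P3cStCharTSWeylCartanOrbInt
open scoped ENNReal NNReal MatrixGroups Pointwise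

namespace Summit.HodgeConjecture.HodgeConjecture.Cruxes.H413.F0P3cStCharTSUpTrTorusIntegrable

section OneCartan

variable {L : Type} [Field L] [NumberField L] [IsCMField L] {v : HeightOneSpectrum (𝓞 ↥(maximalRealSubfield L))}
  {T : Subgroup (Gqs L v)} {γ₀ : Gqs L v} (hγ₀ : IsRegularElt (γ₀.val : GL (Fin 3) (LocalRing L v)))
  (hT : T = Subgroup.centralizer ({γ₀} : Set (Gqs L v)))
  (Φ : (Gqs L v ⧸ T) × ↥T → Gqs L v) (hΦ : ∀ (x : Gqs L v) (t : ↥T), Φ (QuotientGroup.mk x, t) = x * t * x⁻¹)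
  (hns : ∀ w : PlacesOver L v, IsCMField.complexConj L • w.1 = w.1)
  [MeasurableSpace (Gqs L v)] [BorelSpace (Gqs L v)] [LocallyCompactSpace (Gqs L v)] [SecondCountableTopology (Gqs L v)] [T2Space (Gqs L v)]
  [MeasurableSpace (Gqs L v ⧸ T)] [BorelSpace (Gqs L v ⧸ T)]
  (ν : Measure (Gqs L v)) [ν.IsHaarMeasure] [ν.IsMulRightInvariant]
  (tm : Measure ↥T) [tm.IsMulLeftInvariant] [IsFiniteMeasureOnCompacts tm] [tm.IsOpenPosMeasure] [tm.IsInvInvariant]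
  (D : ↥T → ℝ≥0) (hD : Measurable D)

/-! ## §1 Torus-side integrability of the weighted orbital integral from integrability on the `T`-regular set -/

set_option maxHeartbeats 1600000 in
set_option synthInstance.maxHeartbeats 200000 in
-- instance-term unification on the CM local carrier (`quotientMeasure` with its σ-algebra arguments), as in ★ (E1b)
include hγ₀ hΦ hns hD in
/-- **(A0) TORUS-SIDE INTEGRABILITY FROM GROUP-SIDE INTEGRABILITY** (local tube-Jacobian socket `hJacLoc` at `T = Z(γ₀)` with weight `D`, as in ★ (E1b)): if `g : G → ℂ` is
`ν`-integrable on the `T`-regular set `G_T`, then **`t ↦ D(t) • ∫_{G⧸T} g(Φ(q, t)) dμ₀(q)` is `tm`-integrable on `T^{reg}`** — the torus term of the Weyl integration formula is a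
genuine Bochner integrand (first conjunct of ★ `integral_cartanSet_eq_of_tubeJacobian_local`, then `Integrable.integral_prod_left` and `integrable_withDensity_iff_integrable_coe_smul`).
[cite: Rogawski1990, §12.5 p. 182] [cite: HarishChandra1970, Lemma 42] -/
theorem integrableOn_weighted_orbital_of_integrableOn
    (hJacLoc : ∀ t₀ : ↥T, IsRegularElt (((t₀ : Gqs L v)).val : GL (Fin 3) (LocalRing L v)) →
      ∃ U : Set ↥T, IsOpen U ∧ t₀ ∈ U ∧
        ∃ A₀ : Set (Gqs L v ⧸ T), MeasurableSet A₀ ∧ (quotientMeasure T tm (isClosed_cartan hT) ν) A₀ ≠ 0 ∧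
          (quotientMeasure T tm (isClosed_cartan hT) ν) A₀ ≠ ∞ ∧
          ∀ V : Set ↥T, MeasurableSet V → V ⊆ U → (∀ t ∈ V, IsRegularElt (((t : Gqs L v)).val : GL (Fin 3) (LocalRing L v))) →
            (∀ n : Gqs L v, n ∉ T → ∀ t ∈ V, ∀ t' ∈ V, ((t' : ↥T) : Gqs L v) ≠ n * t * n⁻¹) →
              ν (Φ '' (A₀ ×ˢ V)) = (quotientMeasure T tm (isClosed_cartan hT) ν) A₀ * ∫⁻ t in V, (D t : ℝ≥0∞) ∂tm)
    (g : Gqs L v → ℂ) (hg : IntegrableOn g {x | ∃ g t : Gqs L v, t ∈ T ∧ IsRegularElt (t.val : GL (Fin 3) (LocalRing L v)) ∧ g * t * g⁻¹ = x} ν) :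
    IntegrableOn (fun t : ↥T => (D t : ℝ) • ∫ q, g (Φ (q, t)) ∂(quotientMeasure T tm (isClosed_cartan hT) ν))
      {t : ↥T | IsRegularElt (((t : Gqs L v)).val : GL (Fin 3) (LocalRing L v))} tm := by
  obtain ⟨hint, -⟩ := integral_cartanSet_eq_of_tubeJacobian_local hγ₀ hT Φ hΦ hns ν tm D hD hJacLoc g hg
  have hTcl := isClosed_cartan hT
  haveI := hTcl
  haveI : SecondCountableTopology (Gqs L v ⧸ T) := (QuotientGroup.isQuotientMap_mk _).secondCountableTopology QuotientGroup.isOpenMap_coe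
  haveI : LocallyCompactSpace (Gqs L v ⧸ T) := QuotientGroup.instLocallyCompactSpace _
  haveI : SigmaCompactSpace (Gqs L v ⧸ T) := sigmaCompactSpace_of_locallyCompact_secondCountable
  haveI : SigmaFinite (quotientMeasure T tm hTcl ν) := SigmaFinite.of_isFiniteMeasureOnCompacts _
  have h1 := hint.integral_prod_left
  exact (integrable_withDensity_iff_integrable_coe_smul hD).1 h1

set_option maxHeartbeats 1600000 in
set_option synthInstance.maxHeartbeats 200000 in
-- instance-term unification on the CM local carrier, as above
include hγ₀ hΦ hns hD in
/-- **(A0) THE ORBITAL INTEGRAL CONVERGES AT ALMOST EVERY REGULAR POINT OF POSITIVE WEIGHT**: under the same socket, if `g` is `ν`-integrable on `G_T` then for `tm`-a.e. regular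
`t ∈ T` with `D(t) ≠ 0`, `q ↦ g(Φ(q, t))` is `μ₀`-integrable on `G ⧸ T` (first conjunct of ★ (E1b), `Integrable.prod_right_ae`, `ae_withDensity_iff`).
[cite: Rogawski1990, §12.5 p. 182] [cite: HarishChandra1970, Lemma 42] -/
theorem ae_integrable_orbital_of_integrableOn
    (hJacLoc : ∀ t₀ : ↥T, IsRegularElt (((t₀ : Gqs L v)).val : GL (Fin 3) (LocalRing L v)) →
      ∃ U : Set ↥T, IsOpen U ∧ t₀ ∈ U ∧
        ∃ A₀ : Set (Gqs L v ⧸ T), MeasurableSet A₀ ∧ (quotientMeasure T tm (isClosed_cartan hT) ν) A₀ ≠ 0 ∧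
          (quotientMeasure T tm (isClosed_cartan hT) ν) A₀ ≠ ∞ ∧
          ∀ V : Set ↥T, MeasurableSet V → V ⊆ U → (∀ t ∈ V, IsRegularElt (((t : Gqs L v)).val : GL (Fin 3) (LocalRing L v))) →
            (∀ n : Gqs L v, n ∉ T → ∀ t ∈ V, ∀ t' ∈ V, ((t' : ↥T) : Gqs L v) ≠ n * t * n⁻¹) →
              ν (Φ '' (A₀ ×ˢ V)) = (quotientMeasure T tm (isClosed_cartan hT) ν) A₀ * ∫⁻ t in V, (D t : ℝ≥0∞) ∂tm)
    (g : Gqs L v → ℂ) (hg : IntegrableOn g {x | ∃ g t : Gqs L v, t ∈ T ∧ IsRegularElt (t.val : GL (Fin 3) (LocalRing L v)) ∧ g * t * g⁻¹ = x} ν) :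
    ∀ᵐ t ∂(tm.restrict {t : ↥T | IsRegularElt (((t : Gqs L v)).val : GL (Fin 3) (LocalRing L v))}),
      D t ≠ 0 → Integrable (fun q => g (Φ (q, t))) (quotientMeasure T tm (isClosed_cartan hT) ν) := by
  obtain ⟨hint, -⟩ := integral_cartanSet_eq_of_tubeJacobian_local hγ₀ hT Φ hΦ hns ν tm D hD hJacLoc g hg
  have hTcl := isClosed_cartan hT
  haveI := hTcl
  haveI : SecondCountableTopology (Gqs L v ⧸ T) := (QuotientGroup.isQuotientMap_mk _).secondCountableTopology QuotientGroup.isOpenMap_coe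
  haveI : LocallyCompactSpace (Gqs L v ⧸ T) := QuotientGroup.instLocallyCompactSpace _
  haveI : SigmaCompactSpace (Gqs L v ⧸ T) := sigmaCompactSpace_of_locallyCompact_secondCountable
  haveI : SigmaFinite (quotientMeasure T tm hTcl ν) := SigmaFinite.of_isFiniteMeasureOnCompacts _
  have h1 := hint.prod_right_ae
  rw [ae_withDensity_iff hD.coe_nnreal_ennreal] at h1
  filter_upwards [h1] with t ht hDt
  exact ht (by exact_mod_cast hDt)

/-! ## §2 Class-function form: `g = f · α` with `α` a class function on the regular set -/

set_option maxHeartbeats 1600000 in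
set_option synthInstance.maxHeartbeats 200000 in
-- instance-term unification on the CM local carrier, as above
include hγ₀ hΦ hns hD in
/-- **(A0) CLASS-FUNCTION FORM**: for `f α : G → ℂ` with `α(x t x⁻¹) = α(t)` for regular `t` and `f · α` `ν`-integrable on `G_T`, **`t ↦ D(t) • (α(t) · ∫_{G⧸T} f(Φ(q,t)) dμ₀)` is
`tm`-integrable on `T^{reg}`** (§1 and, pointwise on `T^{reg}`, `∫ f(Φ(q,t)) α(Φ(q,t)) dμ₀ = α(t) · ∫ f(Φ(q,t)) dμ₀` as in ★ (E2b) `integral_mul_classFun_eq_sum_of_tubeJacobians`).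
[cite: Rogawski1990, §12.5 p. 182] [cite: HarishChandra1970, Lemma 42] -/
theorem integrableOn_weighted_classFun_mul_orbital
    (hJacLoc : ∀ t₀ : ↥T, IsRegularElt (((t₀ : Gqs L v)).val : GL (Fin 3) (LocalRing L v)) →
      ∃ U : Set ↥T, IsOpen U ∧ t₀ ∈ U ∧
        ∃ A₀ : Set (Gqs L v ⧸ T), MeasurableSet A₀ ∧ (quotientMeasure T tm (isClosed_cartan hT) ν) A₀ ≠ 0 ∧
          (quotientMeasure T tm (isClosed_cartan hT) ν) A₀ ≠ ∞ ∧
          ∀ V : Set ↥T, MeasurableSet V → V ⊆ U → (∀ t ∈ V, IsRegularElt (((t : Gqs L v)).val : GL (Fin 3) (LocalRing L v))) →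
            (∀ n : Gqs L v, n ∉ T → ∀ t ∈ V, ∀ t' ∈ V, ((t' : ↥T) : Gqs L v) ≠ n * t * n⁻¹) →
              ν (Φ '' (A₀ ×ˢ V)) = (quotientMeasure T tm (isClosed_cartan hT) ν) A₀ * ∫⁻ t in V, (D t : ℝ≥0∞) ∂tm)
    (f α : Gqs L v → ℂ) (hα : ∀ x t : Gqs L v, IsRegularElt (t.val : GL (Fin 3) (LocalRing L v)) → α (x * t * x⁻¹) = α t)
    (hfα : IntegrableOn (fun y => f y * α y) {x | ∃ g t : Gqs L v, t ∈ T ∧ IsRegularElt (t.val : GL (Fin 3) (LocalRing L v)) ∧ g * t * g⁻¹ = x} ν) :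
    IntegrableOn (fun t : ↥T => (D t : ℝ) • (α (t : Gqs L v) * ∫ q, f (Φ (q, t)) ∂(quotientMeasure T tm (isClosed_cartan hT) ν)))
      {t : ↥T | IsRegularElt (((t : Gqs L v)).val : GL (Fin 3) (LocalRing L v))} tm := by
  have h1 := integrableOn_weighted_orbital_of_integrableOn hγ₀ hT Φ hΦ hns ν tm D hD hJacLoc (fun y => f y * α y) hfα
  obtain ⟨w⟩ := (inferInstance : Nonempty (PlacesOver L v))
  have hSm : MeasurableSet {t : ↥T | IsRegularElt (((t : Gqs L v)).val : GL (Fin 3) (LocalRing L v))} :=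
    ((isOpen_setOf_isRegularElt_cmDatum_local (L := L) (H := qsForm L) (v := v) w (hns w)).preimage continuous_subtype_val).measurableSet
  refine h1.congr_fun (fun t ht => ?_) hSm
  -- the orbital integral of `f · α` at a regular `t` is `α(t) · Φ(t, f)`: `α(Φ (q, t)) = α(t)` for every `q`
  have hpt : ∀ q : Gqs L v ⧸ T, f (Φ (q, t)) * α (Φ (q, t)) = f (Φ (q, t)) * α (t : Gqs L v) := by
    intro q
    induction q using QuotientGroup.induction_on with
    | H x => rw [hΦ x t, hα x (t : Gqs L v) ht]
  show (D t : ℝ) • ∫ q, f (Φ (q, t)) * α (Φ (q, t)) ∂(quotientMeasure T tm (isClosed_cartan hT) ν) = _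
  simp_rw [hpt]
  rw [integral_mul_const, mul_comm]

/-! ## §3 The organ's currency: canonical orbital integrals and the normalised Haar measure `t_T` -/

set_option maxHeartbeats 1600000 in
set_option synthInstance.maxHeartbeats 200000 in
-- instance-term unification on the CM local carrier, as above
include hγ₀ hΦ hns in
/-- **(A0) IN THE (S-𝔇) ORGAN'S CURRENCY**: with `t_T` a Haar measure on `T` of mass one on `compactCore T` (★ (E3)) and `mQv` CANONICAL for the regular classes, for `f` measurable, `α`
a class function on the regular set and `f · α` `ν`-integrable on `G_T`: **`t ↦ D(t) • (α(t) · classOrbitalIntegral mQv f ⟦t⟧)` is `t_T`-integrable on `T^{reg}`** (§2 and ★ (E3)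
`classOrbitalIntegral_mk_eq_integral_conjFamily_cartan`). [cite: Rogawski1990, §12.5 p. 182; §4.3 (4.3.1) p. 43] [cite: HarishChandra1970, Lemma 42] -/
theorem integrableOn_weighted_classFun_mul_classOrbitalIntegral
    [∀ γ' : Gqs L v, MeasurableSpace (Gqs L v ⧸ Subgroup.centralizer ({γ'} : Set (Gqs L v)))]
    [∀ γ' : Gqs L v, BorelSpace (Gqs L v ⧸ Subgroup.centralizer ({γ'} : Set (Gqs L v)))]
    {mQv : OrbitalMeasureFamily (Gqs L v)} (hcanQ : mQv.IsCanonical (fun γ' => IsRegularElt (γ'.val : GL (Fin 3) (LocalRing L v))) ν)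
    (tT : Measure ↥T) [tT.IsHaarMeasure] [tT.IsInvInvariant] (htT : tT (compactCore ↥T) = 1)
    (D : ↥T → ℝ≥0) (hD : Measurable D)
    (hJacLoc : ∀ t₀ : ↥T, IsRegularElt (((t₀ : Gqs L v)).val : GL (Fin 3) (LocalRing L v)) →
      ∃ U : Set ↥T, IsOpen U ∧ t₀ ∈ U ∧
        ∃ A₀ : Set (Gqs L v ⧸ T), MeasurableSet A₀ ∧ (quotientMeasure T tT (isClosed_cartan hT) ν) A₀ ≠ 0 ∧
          (quotientMeasure T tT (isClosed_cartan hT) ν) A₀ ≠ ∞ ∧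
          ∀ V : Set ↥T, MeasurableSet V → V ⊆ U → (∀ t ∈ V, IsRegularElt (((t : Gqs L v)).val : GL (Fin 3) (LocalRing L v))) →
            (∀ n : Gqs L v, n ∉ T → ∀ t ∈ V, ∀ t' ∈ V, ((t' : ↥T) : Gqs L v) ≠ n * t * n⁻¹) →
              ν (Φ '' (A₀ ×ˢ V)) = (quotientMeasure T tT (isClosed_cartan hT) ν) A₀ * ∫⁻ t in V, (D t : ℝ≥0∞) ∂tT)
    (f α : Gqs L v → ℂ) (hf : Measurable f) (hα : ∀ x t : Gqs L v, IsRegularElt (t.val : GL (Fin 3) (LocalRing L v)) → α (x * t * x⁻¹) = α t)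
    (hfα : IntegrableOn (fun y => f y * α y) {x | ∃ g t : Gqs L v, t ∈ T ∧ IsRegularElt (t.val : GL (Fin 3) (LocalRing L v)) ∧ g * t * g⁻¹ = x} ν) :
    IntegrableOn (fun t : ↥T => (D t : ℝ) • (α (t : Gqs L v) * classOrbitalIntegral mQv f (ConjClasses.mk (t : Gqs L v))))
      {t : ↥T | IsRegularElt (((t : Gqs L v)).val : GL (Fin 3) (LocalRing L v))} tT := by
  have h1 := integrableOn_weighted_classFun_mul_orbital hγ₀ hT Φ hΦ hns ν tT D hD hJacLoc f α hα hfα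
  obtain ⟨w⟩ := (inferInstance : Nonempty (PlacesOver L v))
  have hSm : MeasurableSet {t : ↥T | IsRegularElt (((t : Gqs L v)).val : GL (Fin 3) (LocalRing L v))} :=
    ((isOpen_setOf_isRegularElt_cmDatum_local (L := L) (H := qsForm L) (v := v) w (hns w)).preimage continuous_subtype_val).measurableSet
  refine h1.congr_fun (fun t ht => ?_) hSm
  show (D t : ℝ) • (α (t : Gqs L v) * ∫ q, f (Φ (q, t)) ∂(quotientMeasure T tT (isClosed_cartan hT) ν)) = _
  rw [classOrbitalIntegral_mk_eq_integral_conjFamily_cartan hγ₀ hT ν hcanQ tT htT Φ hΦ t ht f hf]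

end OneCartan

/-! ## §3′ The `ι`-indexed corollary in ★ (E2b) §3's letters (term `i` of `integral_mul_classFun_eq_sum_classOrbitalIntegral_of_tubeJacobians`) -/

section Family

variable {L : Type} [Field L] [NumberField L] [IsCMField L] {v : HeightOneSpectrum (𝓞 ↥(maximalRealSubfield L))}
  {ι : Type*} {T : ι → Subgroup (Gqs L v)} {γ : ι → Gqs L v}
  (hγ : ∀ i, IsRegularElt ((γ i).val : GL (Fin 3) (LocalRing L v))) (hT : ∀ i, T i = Subgroup.centralizer ({γ i} : Set (Gqs L v)))
  (hns : ∀ w : PlacesOver L v, IsCMField.complexConj L • w.1 = w.1)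
  [MeasurableSpace (Gqs L v)] [BorelSpace (Gqs L v)]
  (ν : Measure (Gqs L v))
  [∀ i, MeasurableSpace (Gqs L v ⧸ T i)] [∀ i, BorelSpace (Gqs L v ⧸ T i)]
  (Φ : ∀ i, (Gqs L v ⧸ T i) × ↥(T i) → Gqs L v) (hΦ : ∀ i (x : Gqs L v) (t : ↥(T i)), Φ i (QuotientGroup.mk x, t) = x * t * x⁻¹)

set_option maxHeartbeats 1600000 in
set_option synthInstance.maxHeartbeats 200000 in
-- instance-term unification on the CM local carrier (`quotientMeasure` per `i`), as in ★ (E2b)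
include hγ hΦ hns in
/-- **(A0) FOR THE WHOLE CARTAN FAMILY, (E2b) §3's letters**: `v` non-split, `T i = Z(γ i)`, `t_{T i}` of mass one on the compact cores, `mQv` canonical, local tube Jacobians `hJac i`
with weights `D i`; for `f` measurable, `α` a class function on the regular set and `f · α` `ν`-integrable on `G`, EVERY torus term of the Weyl integration formula
`t ↦ D i t • (α(t) · classOrbitalIntegral mQv f ⟦t⟧)` is `t_{T i}`-integrable on `(T i)^{reg}` — so the right-hand side of ★ `integral_mul_classFun_eq_sum_classOrbitalIntegral_of_tubeJacobians`
is a finite sum of genuine Bochner integrals, which may be transported (`MeasurePreserving.integral_comp`) and added (`integral_finset_sum`) torus by torus.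
[cite: Rogawski1990, §12.5 pp. 182–183] [cite: HarishChandra1970, Lemma 42] -/
theorem integrableOn_weighted_classOrbitalIntegral_of_integrable
    [LocallyCompactSpace (Gqs L v)] [SecondCountableTopology (Gqs L v)] [T2Space (Gqs L v)] [ν.IsHaarMeasure] [ν.IsMulRightInvariant]
    [∀ γ' : Gqs L v, MeasurableSpace (Gqs L v ⧸ Subgroup.centralizer ({γ'} : Set (Gqs L v)))]
    [∀ γ' : Gqs L v, BorelSpace (Gqs L v ⧸ Subgroup.centralizer ({γ'} : Set (Gqs L v)))]
    {mQv : OrbitalMeasureFamily (Gqs L v)} (hcanQ : mQv.IsCanonical (fun γ' => IsRegularElt (γ'.val : GL (Fin 3) (LocalRing L v))) ν)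
    (tT : ∀ i, Measure ↥(T i)) [∀ i, (tT i).IsHaarMeasure] [∀ i, (tT i).IsInvInvariant] (htT : ∀ i, tT i (compactCore ↥(T i)) = 1)
    (D : ∀ i, ↥(T i) → ℝ≥0) (hD : ∀ i, Measurable (D i))
    (hJac : ∀ i, ∀ t₀ : ↥(T i), IsRegularElt (((t₀ : Gqs L v)).val : GL (Fin 3) (LocalRing L v)) →
      ∃ U : Set ↥(T i), IsOpen U ∧ t₀ ∈ U ∧
        ∃ A₀ : Set (Gqs L v ⧸ T i), MeasurableSet A₀ ∧ (quotientMeasure (T i) (tT i) (isClosed_cartan (hT i)) ν) A₀ ≠ 0 ∧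
          (quotientMeasure (T i) (tT i) (isClosed_cartan (hT i)) ν) A₀ ≠ ∞ ∧
          ∀ V : Set ↥(T i), MeasurableSet V → V ⊆ U → (∀ t ∈ V, IsRegularElt (((t : Gqs L v)).val : GL (Fin 3) (LocalRing L v))) →
            (∀ n : Gqs L v, n ∉ T i → ∀ t ∈ V, ∀ t' ∈ V, ((t' : ↥(T i)) : Gqs L v) ≠ n * t * n⁻¹) →
              ν (Φ i '' (A₀ ×ˢ V)) = (quotientMeasure (T i) (tT i) (isClosed_cartan (hT i)) ν) A₀ * ∫⁻ t in V, (D i t : ℝ≥0∞) ∂(tT i))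
    (f α : Gqs L v → ℂ) (hf : Measurable f) (hα : ∀ x t : Gqs L v, IsRegularElt (t.val : GL (Fin 3) (LocalRing L v)) → α (x * t * x⁻¹) = α t)
    (hfα : Integrable (fun y => f y * α y) ν) (i : ι) :
    IntegrableOn (fun t : ↥(T i) => (D i t : ℝ) • (α (t : Gqs L v) * classOrbitalIntegral mQv f (ConjClasses.mk (t : Gqs L v))))
      {t : ↥(T i) | IsRegularElt (((t : Gqs L v)).val : GL (Fin 3) (LocalRing L v))} (tT i) :=
  integrableOn_weighted_classFun_mul_classOrbitalIntegral (hγ i) (hT i) (Φ i) (hΦ i) hns ν hcanQ (tT i) (htT i) (D i) (hD i) (hJac i) f α hf hα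
    hfα.integrableOn

end Family

end Summit.HodgeConjecture.HodgeConjecture.Cruxes.H413.F0P3cStCharTSUpTrTorusIntegrable

end
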